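import Summits.QuantumFields.YangMills.Theorems.UnitScaleTiltProp7FlatBlockInverseEstimate
import Summits.QuantumFields.YangMills.Theorems.UnitScaleTiltProp7BlockBumpExtension
import Literature.MathematicalPhysics.QuantumFieldTheory.Balaban1983to89.B6VecIMSV1
import Literature.MathematicalPhysics.QuantumFieldTheory.Balaban1983to89.T3ContinuumYM3Torus
import HarnessLib

/-!
# Route `UnitScaleTilt`, crux K1 «MinimiserStabilityRegPr» (stmt-QuantumFields-19200), route-R E′ architecture (A′) «HCOW-VIA-Σ», package P-A4 «CRUDE SLICE ON PRINT'S SLICE», FLAT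
# CORE IN ROUTE LETTERS (FILE S1): A SITE FUNCTION WHOSE FLAT LAPLACIAN IS BLOCK-CONSTANT IS BLOCK-SMOOTH —
# `Σ_{B^k(y)}(Δu)² ≤ C₀·ℓ⁻⁴·Σ_{B^k(y)} u²` block by block, hence `Σ(Δu)² ≤ C₀ℓ⁻⁴Σu²` and `ℓ²·Σ|∇u|² ≤ √C₀·Σu²` on the torus (`ℓ = L^k ≥ 3`; `C₀ = 4d²·243^{2d}∕16^{2d−2}`, absolute, crude)

Cell `ym3-torus`, width seat `ym3-torus-px12` (gen 5); LOCATE «(P-A4)-FLAT» (HOME `ym3-torus-px12/g5/LOCATE-PA4FLAT-px12g5.md`, route S).  WHERE IT SITS: the (A′) door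
✓ `Prop7HessOnPrintSlice.div_sq_le_of_bernstein_ker_RS_of_isLandauPrintS` wants the Bernstein row `hBern`: «`R_S(U₀)f = 0 ⇒ ‖D_{U₀}f‖² ≤ C‖f‖²`».  At the flat member `U₀ = 1`,
`R_S f = 0` says `Δ^η f ∈ (ker(Q∘D))ᗮ = range((Q∘D)†)` (✓ `isLandauPrintS_iff_covLapSite_mem_orthogonal`), and by flat (3.115) `(Q_bond∘grad)ᵀ = Q_siteᵀ∘grad_cᵀ`: the flat Laplacian of
`f` is a SITE-AVERAGE TRANSPOSE, i.e. CONSTANT ON EVERY `k`-BLOCK.  This file is the analytic core of that situation in the route's own letters (`Site P 0`, `laplace 1`, `pdiff 1`,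
`iterBlock k y`) with NO Fourier analysis and NO torus dictionary: the EVEN HALF of w8-19936 g5's blockwise inverse estimate ✓ `Prop7FlatBlockInverseEstimate.sum_block_sq_transpose_le` ((R-loc) BRICK (2d), affine bond-transpose data) — the
product bump of ✓ `Prop7FlatProductBump`∕✓ `Prop7FlatBlockRowFactor` with the profile `r²(s−r)²` of ✓ `Prop7FlatBumpProfile`, interior duality ✓ `sq_interior_pairing_le`, and the
profile mass `G ≥ ℓ⁵∕243`.  FILE S2 (the member's `hBern` at `U₀ = 1`) reads it through the `toL2S`∕`DL2 1`∕`covLapSite 1` letters.  THEOREMS ONLY (0 `def`, 0 `sorry`); `--supports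
stmt-QuantumFields-19200`, count-neutral.  YM₃ on T³ is a ladder rung (R3), not the Clay problem; nothing here claims hcoW, (A′), E′, a stub, the crux, d = 4 or the mass gap.

WHAT IS PROVED (ns `…Theorems.Prop7FlatBlockConstLaplace`; any `P : Params`, `k ≤ m + K`, `3 ≤ L^k`).
* §1 `sum_prod_eq_pow` (`Σ_{j : Fin d → Fin ℓ} Π_i g(j_i) = (Σ_r g r)^d`).
* §2 ★★ `sq_const_laplace_le` — `Δu = c` on `B^k(y)` ⟹ `c² ≤ ℓ^d·(d·2ℓ²X)²·(243∕ℓ⁵)^{2d}·Σ_{B^k(y)} u²` (`X = (ℓ⁴∕16)^{d−1}`; raw product form), ★★ `sum_block_sq_laplace_le_of_const`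
  (`Σ_{B^k(y)} (Δu)² ≤ ℓ^{2d}(d·2ℓ²X)²(243∕ℓ⁵)^{2d}·Σ_{B^k(y)} u²` — `= C₀·ℓ⁻⁴`).
* §3 ★★ `sum_sq_laplace_le_of_blockConst` — GLOBAL: `Δu` constant on every `k`-block ⟹ `Σ_x (Δu)² ≤ (same)·Σ_x u²`; ★★★ `sq_sum_pdiff_sq_le_of_blockConst` —
  `(Σ_νΣ_x (∂_νu)²)² ≤ (same)·(Σ_x u²)²` (`Σ|∇u|² = Σ u·Δu ≤ ‖u‖‖Δu‖`, lit ✓ `B6VecIMSV1.sum_mul_laplace_eq_sum_pdiff`).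
* §4 ★★★ `grad_sq_le_of_blockConst_T3` — the T³ reading (`d = 3`, `k = K − n`, `ℓ = L^{K−n} ≥ 3`): `ℓ²·Σ_νΣ_x(∂_νu)² ≤ (6·243³∕256)·Σ_x u²` — ABSOLUTE constant (≈ 3.4·10⁵, crude);
  `sum_pdiff_sq_le_trivial` (`Σ|∇u|² ≤ 4dΣu²`) and ★★★ `grad_sq_le_of_blockConst_T3_all` — the same for EVERY member (`ℓ ≤ 2` by the trivial bound).
HONEST SCOPE.  Flat, real scalar site functions (matrix∕𝔰𝔲(2) fibres entrywise, FILE S2); elementary (bump + duality + Cauchy–Schwarz); the constant is far from sharp (Fourier gives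
`dπ² + (π²∕4)^d(dπ²)²∕4 ≈ 3.3·10³` at d = 3, cf. ✓ `Prop7AliasSumBernstein.alias_sum_mean_le`).  Nothing of [Balaban1984PropagatorsI] beyond the cited tree theorems is asserted.

References: T. Bałaban, CMP 95 (1984) 17–40 [Balaban1984PropagatorsI] ((1.18) p.20, (1.21) p.21, Sect. C p.22); CMP 99 (1985) 75–102 [Balaban1985RegularSpaces] ((1.38) p.82);
CMP 99 (1985) 389–434 [Balaban1985BackgroundPropagators] ((3.21)–(3.23) p.394); M. Giaquinta, Multiple integrals in the calculus of variations (1983) [Giaquinta1984] (Ch. III §2).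
-/

set_option autoImplicit false

noncomputable section

open scoped BigOperators

namespace Summit.QuantumFields.YangMills.Theorems.Prop7FlatBlockConstLaplace

open Literature.MathematicalPhysics.QuantumFieldTheory.Balaban1983to89
open Finset LatticeFieldCalculus
open B5Eq117TorusCarriers (blockSiteK val_blockSiteK sitesPerDir_zero_eq sum_iterBlock_eq)
open B5Eq118OneStroke (iterBlock mem_iterBlock_iff card_iterBlock)
open B6VecIMSV1 (sum_mul_laplace_eq_sum_pdiff)
open Summit.QuantumFields.YangMills.Theorems.Prop7FlatBumpProfile
open Summit.QuantumFields.YangMills.Theorems.Prop7FlatProductBump (prod_eq_zero_off laplace_prod_eq_zero_off abs_laplace_prod_le sq_interior_pairing_le)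
open Summit.QuantumFields.YangMills.Theorems.Prop7FlatBlockRowFactor (factor_off d2_factor_off abs_factor_le abs_d2_factor_le factor_blockSiteK rows_iff_mem_iterBlock)
open Summit.QuantumFields.YangMills.Theorems.Prop7FlatBlockInverseEstimate (one_lt_sitesPerDir_zero)
open Summit.QuantumFields.YangMills.Theorems.Prop7BlockBumpExtension (sum_eq_sum_iterBlock)

variable {P : Params} {k : ℕ}

/-! ## §1 A bookkeeping letter -/

/-- **FUBINI FOR SEPARABLE SUMMANDS**: `Σ_{j : Fin d → Fin ℓ} Π_i g(j_i) = (Σ_r g r)^d`. [folklore] -/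
theorem sum_prod_eq_pow (d ℓ : ℕ) (g : Fin ℓ → ℝ) :
    ∑ j : Fin d → Fin ℓ, ∏ i, g (j i) = (∑ r, g r) ^ d := by
  rw [show (∑ j : Fin d → Fin ℓ, ∏ i, g (j i)) = ∏ _i : Fin d, ∑ r : Fin ℓ, g r by
    rw [Finset.prod_univ_sum]; simp only [Fintype.piFinset_univ]]
  rw [Finset.prod_const, Finset.card_univ, Fintype.card_fin]

/-! ## §2 One block: a constant Laplacian is read by the even bump -/

/-- ★★ **THE CONSTANT SOURCE IS `ℓ⁻²`-SMALLER THAN THE FIELD, RAW FORM**: if `laplace 1 u = c` on the `k`-block `B^k(y)` (`3 ≤ ℓ = L^k`), then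
`c² ≤ ℓ^d·(d·(2ℓ²X))²·(243∕ℓ⁵)^{2d}·Σ_{x∈B^k(y)} u(x)²`, `X = (ℓ⁴∕16)^{d−1}` — interior duality against the product bump `Φ(x) = Π_i r_i²(s−r_i)²` (vanishing with its Laplacian
off the block, `|ΔΦ| ≤ d·2ℓ²X`, `Σ_BΦ = G^d ≥ (ℓ⁵∕243)^d`), then Cauchy–Schwarz. [cite: Balaban1984PropagatorsI, (1.21) p.21, Sect. C p.22; Giaquinta1984, Ch. III §2] -/
theorem sq_const_laplace_le (hk : k ≤ P.m + P.K) (hℓ3 : 3 ≤ P.L ^ k) (u : SiteField P 0 ℝ) (c : ℝ) (y : Site P k)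
    (hLap : ∀ x ∈ iterBlock k y, laplace 1 u x = c) :
    c ^ 2 ≤ ((P.L : ℝ) ^ k) ^ P.d * ((P.d : ℝ) * (2 * ((P.L : ℝ) ^ k) ^ 2 * ((((P.L : ℝ) ^ k) ^ 4 / 16) ^ (P.d - 1)))) ^ 2
        * (∑ x ∈ iterBlock k y, u x ^ 2) * (243 / ((P.L : ℝ) ^ k) ^ 5) ^ (2 * P.d) := by
  classical
  set ℓ : ℕ := P.L ^ k with hℓdef
  have hℓ2 : 2 ≤ ℓ := le_trans (by norm_num) hℓ3
  set s : ℕ := ℓ - 1 with hsdef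
  have hsℓ : s + 1 = ℓ := by omega
  have hℓN : ℓ ∣ P.sitesPerDir 0 := ⟨P.sitesPerDir k, sitesPerDir_zero_eq hk⟩
  haveI : Fact (1 < P.sitesPerDir 0) := ⟨one_lt_sitesPerDir_zero hk hℓ2⟩
  set L : ℝ := (P.L : ℝ) ^ k with hLdef
  have hLℓ : ((ℓ : ℕ) : ℝ) = L := by rw [hℓdef, hLdef]; push_cast; rfl
  have hsR : ((s : ℕ) : ℝ) = L - 1 := by
    rw [← hLℓ, ← hsℓ]; push_cast; ring
  have hL3 : (3 : ℝ) ≤ L := by rw [← hLℓ]; exact_mod_cast hℓ3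
  have hL0 : (0 : ℝ) ≤ L := by linarith only [hL3]
  set X : ℝ := (L ^ 4 / 16) ^ (P.d - 1) with hXdef
  have hX0 : 0 ≤ X := by positivity
  -- the 1-D profile and its bounds
  set g : ℕ → ℝ := fun r => ((r : ℕ) : ℝ) ^ 2 * (((s : ℕ) : ℝ) - r) ^ 2 with hgdef
  have hg0 : g 0 = 0 := by simp [hgdef]
  have hgl : g (ℓ - 1) = 0 := by simp [hgdef, hsdef]
  have hrs : ∀ r : ℕ, r < ℓ → (0 : ℝ) ≤ r ∧ ((r : ℕ) : ℝ) ≤ ((s : ℕ) : ℝ) ∧ ((s : ℕ) : ℝ) + 1 ≤ L := fun r hr =>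
    ⟨Nat.cast_nonneg r, by exact_mod_cast (by omega : r ≤ s), by rw [hsR]; linarith only []⟩
  have hMg : ∀ r, r < ℓ → |g r| ≤ L ^ 4 / 16 := fun r hr => by
    obtain ⟨h1, h2, h3⟩ := hrs r hr
    simp only [hgdef]
    rw [abs_of_nonneg (profile_nonneg _ _)]
    exact profile_le h1 h2 (by linarith only [h3])
  have hs0 : (0 : ℝ) ≤ ((s : ℕ) : ℝ) := Nat.cast_nonneg s
  have hs1L : ((s : ℕ) : ℝ) + 1 ≤ L := by rw [hsR]; linarith only []
  have hKg_int : ∀ r, 1 ≤ r → r ≤ ℓ - 2 → |2 * g r - g (r + 1) - g (r - 1)| ≤ 2 * L ^ 2 := by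
    intro r h1 h2
    obtain ⟨a1, a2, a3⟩ := hrs r (by omega)
    have e1 : (((r + 1 : ℕ)) : ℝ) = (r : ℝ) + 1 := by push_cast; ring
    have e2 : (((r - 1 : ℕ)) : ℝ) = (r : ℝ) - 1 := by rw [Nat.cast_sub h1]; push_cast; ring
    simp only [hgdef]
    rw [e1, e2]
    exact abs_d2_profile_le a1 a2 a3
  have hKg_first : |2 * g 0 - g 1| ≤ 2 * L ^ 2 := by
    rw [hg0, mul_zero, zero_sub, abs_neg]
    simp only [hgdef]
    push_cast
    rw [abs_of_nonneg (profile_nonneg _ _)]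
    have h1 := abs_bdry_profile_le hs0 hs1L
    have h2 : (0:ℝ) ≤ L ^ 2 := by positivity
    linarith only [h1, h2]
  have hKg_last : |2 * g (ℓ - 1) - g (ℓ - 2)| ≤ 2 * L ^ 2 := by
    rw [hgl, mul_zero, zero_sub, abs_neg]
    have e2 : (((ℓ - 2 : ℕ)) : ℝ) = ((s : ℕ) : ℝ) - 1 := by
      rw [hsR, ← hLℓ, Nat.cast_sub hℓ2]; push_cast; ring
    simp only [hgdef]
    rw [e2, profile_sub_one, abs_of_nonneg (profile_nonneg _ _)]
    have h1 := abs_bdry_profile_le hs0 hs1L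
    have h2 : (0:ℝ) ≤ L ^ 2 := by positivity
    linarith only [h1, h2]
  -- the row factors and the product bump
  set Wg : Fin P.d → ZMod (P.sitesPerDir 0) → ℝ := fun i a => if a.val / ℓ = (y i).val then g (a.val % ℓ) else 0 with hWg
  have hW0g : ∀ (i : Fin P.d) (a : ZMod (P.sitesPerDir 0)), ¬ (a.val / ℓ = (y i).val) → Wg i a = 0 := fun i a ha => by
    simp only [hWg]; exact factor_off _ g a ha
  have hD0g : ∀ (i : Fin P.d) (a : ZMod (P.sitesPerDir 0)), ¬ (a.val / ℓ = (y i).val) → 2 * Wg i a - Wg i (a + 1) - Wg i (a - 1) = 0 := fun i a ha => by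
    simp only [hWg]; exact d2_factor_off hℓN hℓ2 _ g hg0 hgl a ha
  have hMg' : ∀ (i : Fin P.d) (a : ZMod (P.sitesPerDir 0)), |Wg i a| ≤ L ^ 4 / 16 := fun i a => by
    simp only [hWg]; exact abs_factor_le hℓ2 _ g (by positivity) hMg a
  have hKg' : ∀ (i : Fin P.d) (a : ZMod (P.sitesPerDir 0)), |2 * Wg i a - Wg i (a + 1) - Wg i (a - 1)| ≤ 2 * L ^ 2 := fun i a => by
    simp only [hWg]; exact abs_d2_factor_le hℓN hℓ2 _ g hg0 hgl (by positivity) hKg_int hKg_first hKg_last a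
  set S : Finset (Site P 0) := iterBlock k y with hSdef
  have hnotS : ∀ x : Site P 0, x ∉ S → ¬ ∀ i : Fin P.d, (x i).val / ℓ = (y i).val := fun x hx hall =>
    hx ((rows_iff_mem_iterBlock hk y x).mp hall)
  have hΦS : ∀ x : Site P 0, x ∉ S → (fun z : Site P 0 => ∏ i, Wg i (z i)) x = 0 := fun x hx =>
    prod_eq_zero_off Wg (fun i a => a.val / ℓ = (y i).val) hW0g x (hnotS x hx)
  have hΔΦS : ∀ x : Site P 0, x ∉ S → laplace 1 (fun z : Site P 0 => ∏ i, Wg i (z i)) x = 0 := fun x hx =>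
    laplace_prod_eq_zero_off Wg (fun i a => a.val / ℓ = (y i).val) hW0g hD0g x (hnotS x hx)
  have hAΦ : ∀ x ∈ S, |laplace 1 (fun z : Site P 0 => ∏ i, Wg i (z i)) x| ≤ (P.d : ℝ) * (2 * L ^ 2 * X) := by
    intro x _
    refine (abs_laplace_prod_le Wg (fun _ => L ^ 4 / 16) (fun _ => 2 * L ^ 2) hMg' hKg' x).trans (le_of_eq ?_)
    simp only [Finset.prod_const, Finset.card_erase_of_mem (Finset.mem_univ _), Finset.card_univ, Fintype.card_fin, Finset.sum_const,
      nsmul_eq_mul, hXdef]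
  -- interior duality + Cauchy–Schwarz, with the constant source
  have hLapS : ∀ x ∈ S, laplace 1 u x = (fun _ : Site P 0 => c) x := fun x hx => hLap x (by rw [hSdef] at hx; exact hx)
  have E1 := sq_interior_pairing_le (fun z : Site P 0 => ∏ i, Wg i (z i)) u (fun _ => c) S hΦS hΔΦS hLapS hAΦ
  have hcard : (S.card : ℝ) = L ^ P.d := by
    rw [hSdef, card_iterBlock k hk y]; push_cast; rw [hLdef, ← pow_mul, ← pow_mul, mul_comm]
  rw [hcard] at E1
  -- the pairing is `c·G^d`
  have hΦj : ∀ j : Fin P.d → Fin (P.L ^ k), (∏ i, Wg i ((blockSiteK k y j) i)) = ∏ i, g (j i) := fun j =>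
    Finset.prod_congr rfl fun i _ => by simp only [hWg]; exact factor_blockSiteK hk y j g i
  have hG : L ^ 5 / 243 ≤ ∑ r : Fin (P.L ^ k), g r := by
    rw [Fin.sum_univ_eq_sum_range (fun r => g r) (P.L ^ k)]
    have := sum_profile_ge hℓ3
    rw [hLℓ] at this
    simp only [hgdef, hsdef]
    exact this
  set G : ℝ := ∑ r : Fin (P.L ^ k), g r with hGdef
  have hPe : ∑ x ∈ S, (fun z : Site P 0 => ∏ i, Wg i (z i)) x * (fun _ : Site P 0 => c) x = c * G ^ P.d := by
    rw [hSdef, sum_iterBlock_eq hk y]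
    simp only []
    rw [Finset.sum_congr rfl fun j _ => by rw [hΦj j], ← Finset.sum_mul]
    have e : ∑ j : Fin P.d → Fin (P.L ^ k), ∏ i, g (j i) = G ^ P.d := sum_prod_eq_pow P.d (P.L ^ k) (fun r => g r)
    rw [e, mul_comm]
  rw [hPe] at E1
  set U : ℝ := ∑ x ∈ S, u x ^ 2 with hUdef
  have hU0 : 0 ≤ U := Finset.sum_nonneg fun x _ => sq_nonneg _
  have hL5 : 0 < L ^ 5 / 243 := by positivity
  have hG0 : 0 < G := lt_of_lt_of_le hL5 hG
  have hq : 1 ≤ G * (243 / L ^ 5) := by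
    rw [← div_le_iff₀ (by positivity)]; rw [one_div, inv_div]; exact hG
  have h1 : c ^ 2 ≤ c ^ 2 * (G * (243 / L ^ 5)) ^ (2 * P.d) := le_mul_of_one_le_right (sq_nonneg _) (one_le_pow₀ hq)
  have h2 : c ^ 2 * (G * (243 / L ^ 5)) ^ (2 * P.d) = (c * G ^ P.d) ^ 2 * (243 / L ^ 5) ^ (2 * P.d) := by ring
  rw [h2] at h1
  exact h1.trans (mul_le_mul_of_nonneg_right E1 (by positivity))

/-- ★★ **THE BLOCKWISE INVERSE ESTIMATE FOR A BLOCK-CONSTANT LAPLACIAN**: `laplace 1 u = c` on `B^k(y)` (`3 ≤ L^k`) ⟹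
`Σ_{x∈B^k(y)} (laplace 1 u x)² ≤ ℓ^{2d}·(d·2ℓ²X)²·(243∕ℓ⁵)^{2d}·Σ_{x∈B^k(y)} u(x)²` (raw product form; `= (4d²·243^{2d}∕16^{2d−2})·ℓ⁻⁴`).
[cite: Balaban1984PropagatorsI, (1.21) p.21, Sect. C p.22; Giaquinta1984, Ch. III §2] -/
theorem sum_block_sq_laplace_le_of_const (hk : k ≤ P.m + P.K) (hℓ3 : 3 ≤ P.L ^ k) (u : SiteField P 0 ℝ) (c : ℝ) (y : Site P k)
    (hLap : ∀ x ∈ iterBlock k y, laplace 1 u x = c) :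
    ∑ x ∈ iterBlock k y, laplace 1 u x ^ 2
      ≤ (((P.L : ℝ) ^ k) ^ P.d * (((P.L : ℝ) ^ k) ^ P.d * ((P.d : ℝ) * (2 * ((P.L : ℝ) ^ k) ^ 2 * ((((P.L : ℝ) ^ k) ^ 4 / 16) ^ (P.d - 1)))) ^ 2
          * (243 / ((P.L : ℝ) ^ k) ^ 5) ^ (2 * P.d)))
        * ∑ x ∈ iterBlock k y, u x ^ 2 := by
  have hc := sq_const_laplace_le hk hℓ3 u c y hLap
  have hcard : ((iterBlock k y).card : ℝ) = ((P.L : ℝ) ^ k) ^ P.d := by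
    rw [card_iterBlock k hk y]; push_cast; rw [← pow_mul, ← pow_mul, mul_comm]
  have hsum : ∑ x ∈ iterBlock k y, laplace 1 u x ^ 2 = ((P.L : ℝ) ^ k) ^ P.d * c ^ 2 := by
    rw [Finset.sum_congr rfl fun x hx => by rw [hLap x hx], Finset.sum_const, nsmul_eq_mul, hcard]
  rw [hsum]
  have hLd : 0 ≤ ((P.L : ℝ) ^ k) ^ P.d := by positivity
  have := mul_le_mul_of_nonneg_left hc hLd
  refine this.trans (le_of_eq ?_)
  ring

/-! ## §3 The whole torus: block-constant Laplacian ⟹ block-smooth -/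

/-- ★★ **GLOBAL INVERSE ESTIMATE**: if `laplace 1 u` is constant on every `k`-block (`3 ≤ L^k`), then `Σ_x (laplace 1 u x)² ≤ (C₀·ℓ⁻⁴, raw form)·Σ_x u(x)²`.
[cite: Balaban1984PropagatorsI, (1.18) p.20, (1.21) p.21, Sect. C p.22] -/
theorem sum_sq_laplace_le_of_blockConst (hk : k ≤ P.m + P.K) (hℓ3 : 3 ≤ P.L ^ k) (u : SiteField P 0 ℝ) (c : Site P k → ℝ)
    (hLap : ∀ (y : Site P k), ∀ x ∈ iterBlock k y, laplace 1 u x = c y) :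
    ∑ x : Site P 0, laplace 1 u x ^ 2
      ≤ (((P.L : ℝ) ^ k) ^ P.d * (((P.L : ℝ) ^ k) ^ P.d * ((P.d : ℝ) * (2 * ((P.L : ℝ) ^ k) ^ 2 * ((((P.L : ℝ) ^ k) ^ 4 / 16) ^ (P.d - 1)))) ^ 2
          * (243 / ((P.L : ℝ) ^ k) ^ 5) ^ (2 * P.d)))
        * ∑ x : Site P 0, u x ^ 2 := by
  rw [sum_eq_sum_iterBlock (k := k) (fun x => laplace 1 u x ^ 2), sum_eq_sum_iterBlock (k := k) (fun x => u x ^ 2), Finset.mul_sum]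
  exact Finset.sum_le_sum fun y _ => sum_block_sq_laplace_le_of_const hk hℓ3 u (c y) y (hLap y)

/-- ★★★ **THE DIRICHLET FORM OF A BLOCK-SMOOTH FUNCTION**: under the same hypothesis, `(Σ_νΣ_x (∂_νu)(x)²)² ≤ (C₀·ℓ⁻⁴, raw form)·(Σ_x u(x)²)²` — since
`Σ_νΣ_x(∂_νu)² = Σ_x u·(laplace 1 u)` (lit ✓ `sum_mul_laplace_eq_sum_pdiff`) `≤ ‖u‖·‖laplace 1 u‖` (Cauchy–Schwarz); i.e. `ℓ²·Σ|∇u|² ≤ √C₀·Σu²`.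
[cite: Balaban1984PropagatorsI, (1.21) p.21, Sect. C p.22] -/
theorem sq_sum_pdiff_sq_le_of_blockConst (hk : k ≤ P.m + P.K) (hℓ3 : 3 ≤ P.L ^ k) (u : SiteField P 0 ℝ) (c : Site P k → ℝ)
    (hLap : ∀ (y : Site P k), ∀ x ∈ iterBlock k y, laplace 1 u x = c y) :
    (∑ ν : Fin P.d, ∑ x : Site P 0, pdiff 1 ν u x ^ 2) ^ 2
      ≤ (((P.L : ℝ) ^ k) ^ P.d * (((P.L : ℝ) ^ k) ^ P.d * ((P.d : ℝ) * (2 * ((P.L : ℝ) ^ k) ^ 2 * ((((P.L : ℝ) ^ k) ^ 4 / 16) ^ (P.d - 1)))) ^ 2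
          * (243 / ((P.L : ℝ) ^ k) ^ 5) ^ (2 * P.d)))
        * (∑ x : Site P 0, u x ^ 2) ^ 2 := by
  have hD : ∑ ν : Fin P.d, ∑ x : Site P 0, pdiff 1 ν u x ^ 2 = ∑ x : Site P 0, u x * laplace 1 u x := by
    rw [sum_mul_laplace_eq_sum_pdiff]
    exact Finset.sum_congr rfl fun ν _ => Finset.sum_congr rfl fun x _ => by ring
  have hcs := Finset.sum_mul_sq_le_sq_mul_sq (Finset.univ : Finset (Site P 0)) u (fun x => laplace 1 u x)
  have hΔ := sum_sq_laplace_le_of_blockConst hk hℓ3 u c hLap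
  have hu0 : 0 ≤ ∑ x : Site P 0, u x ^ 2 := Finset.sum_nonneg fun x _ => sq_nonneg _
  rw [hD]
  calc (∑ x : Site P 0, u x * laplace 1 u x) ^ 2 ≤ (∑ x : Site P 0, u x ^ 2) * ∑ x : Site P 0, laplace 1 u x ^ 2 := hcs
    _ ≤ (∑ x : Site P 0, u x ^ 2) * ((((P.L : ℝ) ^ k) ^ P.d * (((P.L : ℝ) ^ k) ^ P.d * ((P.d : ℝ) * (2 * ((P.L : ℝ) ^ k) ^ 2 * ((((P.L : ℝ) ^ k) ^ 4 / 16) ^ (P.d - 1)))) ^ 2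
          * (243 / ((P.L : ℝ) ^ k) ^ 5) ^ (2 * P.d))) * ∑ x : Site P 0, u x ^ 2) := mul_le_mul_of_nonneg_left hΔ hu0
    _ = _ := by ring

/-! ## §4 ★★★ The T³ reading with an absolute constant -/

/-- ★★★ **BLOCK-CONSTANT LAPLACIAN ⟹ BLOCK-SMOOTH, T³ LETTERS** (`d = 3`, run `K` of a T³ family, `k = K − n`, `ℓ = L^{K−n} ≥ 3`): if `laplace 1 u` is constant on every
`(K−n)`-block of `Site (F.P K) 0`, then `ℓ²·Σ_νΣ_x (∂_νu)(x)² ≤ (6·243³∕256)·Σ_x u(x)²` — the flat `hBern` core of PLAN (A′) P-A4 at the member (`D*X̃` for `IsLandauPrintS 1 X` has a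
block-constant Laplacian entrywise, FILE S2).  Constant absolute and crude (`√C₀(3) = 2·3·243³∕16² ≈ 3.4·10⁵`).
[cite: Balaban1984PropagatorsI, (1.18) p.20, (1.21) p.21, Sect. C p.22; Balaban1985RegularSpaces, (1.38) p.82; Balaban1985BackgroundPropagators, (3.21) p.394] -/
theorem grad_sq_le_of_blockConst_T3 (F : T3ContinuumYM3Torus.T3Family) (K n : ℕ) (hℓ3 : 3 ≤ F.L ^ (K - n)) (u : SiteField (F.P K) 0 ℝ)
    (c : Site (F.P K) (K - n) → ℝ) (hLap : ∀ (y : Site (F.P K) (K - n)), ∀ x ∈ iterBlock (K - n) y, laplace 1 u x = c y) :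
    ((F.L : ℝ) ^ (K - n)) ^ 2 * ∑ ν : Fin (F.P K).d, ∑ x : Site (F.P K) 0, pdiff 1 ν u x ^ 2
      ≤ (6 * 243 ^ 3 / 256) * ∑ x : Site (F.P K) 0, u x ^ 2 := by
  have hk : K - n ≤ (F.P K).m + (F.P K).K := by
    have := F.hm
    show K - n ≤ F.m + K
    omega
  have h := sq_sum_pdiff_sq_le_of_blockConst (P := F.P K) hk hℓ3 u c hLap
  set ℓ : ℝ := (F.L : ℝ) ^ (K - n) with hℓdef
  have hL1 : (1 : ℝ) < F.L := by exact_mod_cast F.hL.2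
  have hℓpos : (0 : ℝ) < ℓ := pow_pos (by linarith) _
  set D : ℝ := ∑ ν : Fin (F.P K).d, ∑ x : Site (F.P K) 0, pdiff 1 ν u x ^ 2 with hDdef
  set M : ℝ := ∑ x : Site (F.P K) 0, u x ^ 2 with hMdef
  have hD0 : 0 ≤ D := Finset.sum_nonneg fun _ _ => Finset.sum_nonneg fun _ _ => sq_nonneg _
  have hM0 : 0 ≤ M := Finset.sum_nonneg fun _ _ => sq_nonneg _
  -- `(F.P K).d = 3` and `(F.P K).L = F.L` definitionally
  have h' : D ^ 2 ≤ ℓ ^ 3 * (ℓ ^ 3 * (((3 : ℕ) : ℝ) * (2 * ℓ ^ 2 * ((ℓ ^ 4 / 16) ^ (3 - 1)))) ^ 2 * (243 / ℓ ^ 5) ^ (2 * 3)) * M ^ 2 := h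
  -- the raw constant at `d = 3` is `(6·243³∕256)²·ℓ⁻⁴`
  have hraw : ℓ ^ 3 * (ℓ ^ 3 * (((3 : ℕ) : ℝ) * (2 * ℓ ^ 2 * ((ℓ ^ 4 / 16) ^ (3 - 1)))) ^ 2 * (243 / ℓ ^ 5) ^ (2 * 3))
      = ((6 * 243 ^ 3 / 256) / ℓ ^ 2) ^ 2 := by
    have hℓne : ℓ ≠ 0 := hℓpos.ne'
    push_cast
    field_simp
    ring
  rw [hraw, ← mul_pow] at h'
  have hC0 : 0 ≤ (6 * 243 ^ 3 / 256) / ℓ ^ 2 * M := by positivity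
  have h3 : D ≤ (6 * 243 ^ 3 / 256) / ℓ ^ 2 * M := (pow_le_pow_iff_left₀ hD0 hC0 two_ne_zero).mp h'
  have hℓ2 : 0 < ℓ ^ 2 := by positivity
  have h4 := mul_le_mul_of_nonneg_left h3 hℓ2.le
  refine h4.trans (le_of_eq ?_)
  have hℓne : ℓ ^ 2 ≠ 0 := hℓ2.ne'
  field_simp


/-- **THE TRIVIAL GRADIENT BOUND** (any site function, any `j`): `Σ_νΣ_x (∂_νu)(x)² ≤ 4d·Σ_x u(x)²` (`(a − b)² ≤ 2a² + 2b²`, torus shift invariance). [folklore] -/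
theorem sum_pdiff_sq_le_trivial {j : ℕ} (u : SiteField P j ℝ) :
    ∑ ν : Fin P.d, ∑ x : Site P j, pdiff 1 ν u x ^ 2 ≤ 4 * P.d * ∑ x : Site P j, u x ^ 2 := by
  have hν : ∀ ν : Fin P.d, ∑ x : Site P j, pdiff 1 ν u x ^ 2 ≤ 4 * ∑ x : Site P j, u x ^ 2 := by
    intro ν
    have hshift : ∑ x : Site P j, u (x.shift ν) ^ 2 = ∑ x : Site P j, u x ^ 2 :=
      Equiv.sum_comp (shiftEquiv (P := P) (j := j) ν) (fun y => u y ^ 2)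
    have hpt : ∀ x : Site P j, pdiff 1 ν u x ^ 2 ≤ 2 * u (x.shift ν) ^ 2 + 2 * u x ^ 2 := by
      intro x
      simp only [pdiff, one_smul]
      nlinarith [sq_nonneg (u (x.shift ν) + u x)]
    calc ∑ x : Site P j, pdiff 1 ν u x ^ 2 ≤ ∑ x : Site P j, (2 * u (x.shift ν) ^ 2 + 2 * u x ^ 2) := Finset.sum_le_sum fun x _ => hpt x
      _ = 4 * ∑ x : Site P j, u x ^ 2 := by rw [Finset.sum_add_distrib, ← Finset.mul_sum, ← Finset.mul_sum, hshift]; ring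
  calc ∑ ν : Fin P.d, ∑ x : Site P j, pdiff 1 ν u x ^ 2 ≤ ∑ _ν : Fin P.d, 4 * ∑ x : Site P j, u x ^ 2 := Finset.sum_le_sum fun ν _ => hν ν
    _ = 4 * P.d * ∑ x : Site P j, u x ^ 2 := by rw [Finset.sum_const, Finset.card_univ, Fintype.card_fin, nsmul_eq_mul]; ring

/-- ★★★ **BLOCK-CONSTANT LAPLACIAN ⟹ BLOCK-SMOOTH, T³ LETTERS, EVERY MEMBER** (no size hypothesis: for `ℓ = L^{K−n} ≤ 2` the trivial bound `ℓ²·4d ≤ 48` does it):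
`ℓ²·Σ_νΣ_x (∂_νu)(x)² ≤ (6·243³∕256)·Σ_x u(x)²` whenever `laplace 1 u` is constant on every `(K−n)`-block — the form FILE S2 consumes for the flat member of `bern_P`
(★★OWNER RULING g28-№15 (c3)). [cite: Balaban1984PropagatorsI, (1.18) p.20, (1.21) p.21, Sect. C p.22; Balaban1985BackgroundPropagators, (3.21) p.394, (3.42) p.398] -/
theorem grad_sq_le_of_blockConst_T3_all (F : T3ContinuumYM3Torus.T3Family) (K n : ℕ) (u : SiteField (F.P K) 0 ℝ)
    (c : Site (F.P K) (K - n) → ℝ) (hLap : ∀ (y : Site (F.P K) (K - n)), ∀ x ∈ iterBlock (K - n) y, laplace 1 u x = c y) :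
    ((F.L : ℝ) ^ (K - n)) ^ 2 * ∑ ν : Fin (F.P K).d, ∑ x : Site (F.P K) 0, pdiff 1 ν u x ^ 2
      ≤ (6 * 243 ^ 3 / 256) * ∑ x : Site (F.P K) 0, u x ^ 2 := by
  by_cases h3 : 3 ≤ F.L ^ (K - n)
  · exact grad_sq_le_of_blockConst_T3 F K n h3 u c hLap
  · -- `ℓ ≤ 2`: the trivial bound
    have hℓ2 : F.L ^ (K - n) ≤ 2 := by omega
    have hℓR : ((F.L : ℝ) ^ (K - n)) ≤ 2 := by exact_mod_cast hℓ2
    have hℓ0 : 0 ≤ ((F.L : ℝ) ^ (K - n)) := by positivity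
    have hsq : ((F.L : ℝ) ^ (K - n)) ^ 2 ≤ 4 := by nlinarith
    have htriv := sum_pdiff_sq_le_trivial (P := F.P K) (j := 0) u
    have hd : ((F.P K).d : ℝ) = 3 := by norm_num [show (F.P K).d = 3 from rfl]
    rw [hd] at htriv
    have hM0 : 0 ≤ ∑ x : Site (F.P K) 0, u x ^ 2 := Finset.sum_nonneg fun _ _ => sq_nonneg _
    have hD0 : 0 ≤ ∑ ν : Fin (F.P K).d, ∑ x : Site (F.P K) 0, pdiff 1 ν u x ^ 2 :=
      Finset.sum_nonneg fun _ _ => Finset.sum_nonneg fun _ _ => sq_nonneg _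
    calc ((F.L : ℝ) ^ (K - n)) ^ 2 * ∑ ν : Fin (F.P K).d, ∑ x : Site (F.P K) 0, pdiff 1 ν u x ^ 2
        ≤ 4 * (4 * 3 * ∑ x : Site (F.P K) 0, u x ^ 2) := mul_le_mul hsq htriv hD0 (by norm_num)
      _ ≤ (6 * 243 ^ 3 / 256) * ∑ x : Site (F.P K) 0, u x ^ 2 := by nlinarith

end Summit.QuantumFields.YangMills.Theorems.Prop7FlatBlockConstLaplace

end
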